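import Summits.QuantumFields.YangMills.Theorems.BalabanUVNodesN18CombStepAxialGauge
import HarnessLib

/-!
# N18 (β)-transport letters: THE AXIAL GAUGE ON THE BOX OF A COARSE DIRECTION PAIR (`B(y) ∪ B(y+e_μ) ∪ B(y+e_ν) ∪ B(y+e_μ+e_ν)`, `μ = ν` allowed)

[DAGN18W3-G5 INTENT-4, file (4a)] — count-neutral helper toward K3⁸ `stmt-QuantumFields-27366` (K3⁷ `stmt-QuantumFields-20544` aside; NOT claimed, NOT closed).
YM mass gap (Clay) NOT proved by any of this; R4 closes the conditional finite-𝕋⁴ rung `BalabanLadder.UV` only.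

WHY.  The C¹ cancelled sum of FILE 7's `hrest` (`|∇^ξ_{U_A,ν}(A′_A − i∇l)(·, μ)|` at a direction pair `(x, ν, μ)` of run A's frame) compares the block averages of `A′` at the
coarse bonds `⟨x̂, μ⟩` and `⟨x̂ + e_ν, μ⟩`; the telescoping along `e_ν` sweeps the fine blocks `B(x̂) ∪ B(x̂+e_μ) ∪ B(x̂+e_ν) ∪ B(x̂+e_ν+e_μ)` (three blocks in a row when
`ν = μ`).  This file extends INTENT-1's two-block axial-gauge bookkeeping (p630236) to that box: relative positions `[−h, h]ᵈ + [0,L]e_μ + [0,L]e_ν` about `emb x̂`,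
no wrap-around for `j + 2 ≤ m + K`, the pullback dictionary, and ★ `‖U^{v₀}(b) − 1‖ ≤ ((d+4)L∕2)·α` on the box bonds from the box plaquettes, `v₀ = axialT U (emb x̂)`.

WHAT (ns `YMDAG.N18.TransportOfRecord`): `rel_emb_blockSite_shift_shift`, `blockOf_transl_emb_pairBox` (a box point lies in one of the (three or) four blocks; the
`μ ≠ ν` case is pub-balaban3d's `blockOf_mem_four_of_near` pattern, here uniformly with `μ = ν`), `inBox_rel_of_pairBlocks`, `noWrap_of_inPairBox`, `two_mul_l1_le_of_inPairBox`,
`rel_tgt_of_pairBlocks`, `pairBox_lo_le_hi`, `agreeOn_pull_of_pairBlocks`, `axialT_congr_of_pairBlocks`, `pull_mem_U1_of_pairBlocks`, `norm_hol_pull_plaqWord_sub_one_le_of_pairBlocks`,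
★ `norm_gaugeU_axialT_sub_one_le_of_pairBlocks`.

0 `def`, 0 `sorry`.  References: T. Bałaban, CMP **98** (1985) [Balaban1985Averaging] ((8)–(9) pp.18–19, (19)–(20) p.21, pp.24–25, Prop. 3 p.36); CMP **109** (1987)
[Balaban1987RG1] ((0.1)–(0.4) pp.251–253, (1.13) p.262); CMP **102** (1985) [Balaban1985UV3] ((27) p.263).
-/

noncomputable section

open scoped BigOperators Matrix.Norms.L2Operator

namespace YMDAG.N18.TransportOfRecord

open Literature.MathematicalPhysics.QuantumFieldTheory.Balaban1983to89
open Literature.MathematicalPhysics.QuantumFieldTheory.Balaban1983to89.T4Continuum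
open Literature.MathematicalPhysics.QuantumFieldTheory.Balaban1983to89.BlockAveraging
open Literature.MathematicalPhysics.QuantumFieldTheory.Balaban1983to89.B12RegularSpaces111 (gaugeU plaq plaq_eq)
open Literature.MathematicalPhysics.QuantumFieldTheory.Balaban1983to89.B7Prop1Explicit renaming Site → LSite
open Literature.MathematicalPhysics.QuantumFieldTheory.Balaban1983to89.B7Prop1Explicit (e e_apply l1 U1 mem_U1 hol hol_mem treeWord plaqWord
  norm_inv_sub_one_le)
open Literature.MathematicalPhysics.QuantumFieldTheory.Balaban1983to89.B7Prop1Local (InBox PlaqIn AgreeOn hol_treeWord_congr)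
open Literature.MathematicalPhysics.QuantumFieldTheory.Balaban1983to89.B10Eq27TorusAxialLog (transl transl_apply transl_add transl_add_e transl_zero pull
  pull_apply hol_pull hol_pull_zero holT rel rel_apply rel_transl_of_mem rel_shift_of_le axialT axialT_self holT_contourT_eq_gaugeActT
  norm_holT_contourT_sub_one_le gaugeActT gaugeActT_apply holT_plaqWord holT_plaqWord_swap)
open YMDAG.N18.BoxStokes (inBox_add_e_of_inBox_add_add)
open Literature.MathematicalPhysics.QuantumFieldTheory.Balaban1983to89.BlockAveragingSectionQsstar (eq_blockSite_blockEquiv)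

variable {P : Params} {j : ℕ}

/-! ## §1 Geometry of the pair box `[−h, h]ᵈ + [0, L]e_μ + [0, L]e_ν` about `emb y` -/

section Geometry

/-- The relative position of a site of `B(y + e_μ + e_ν)` with respect to `emb y` is `Le_μ + Le_ν +` its centred offset (no wrap for `j + 2 ≤ m + K`; `μ = ν` allowed).
[cite: Balaban1987RG1, (0.3)-(0.4) pp.252-253] -/
theorem rel_emb_blockSite_shift_shift (hj2 : j + 2 ≤ P.m + P.K) (y : Site P (j + 1)) (μ ν : Fin P.d) (r : Fin P.d → Fin P.L) :
    rel (emb y) (Site.blockSite ((y.shift μ).shift ν) r) = ((P.L : ℕ) : ℤ) • e μ + ((P.L : ℕ) : ℤ) • e ν + off r := by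
  have hx : Site.blockSite ((y.shift μ).shift ν) r = transl (emb y) (((P.L : ℕ) : ℤ) • e μ + ((P.L : ℕ) : ℤ) • e ν + off r) := by
    rw [transl_add, transl_add, transl_emb_seg, transl_emb_seg, transl_emb_off]
  rw [hx]
  refine rel_transl_of_mem _ _ fun κ => ?_
  have hL : (2 : ℤ) * (((P.L - 1) / 2 : ℕ) : ℤ) + 1 = P.L := by exact_mod_cast AveragingRT.two_mul_half_add_one P
  have hn : (2 : ℤ) * ((P.L : ℤ) * P.L) ≤ (P.sitesPerDir j : ℤ) := by
    have := two_mul_sq_le_sitesPerDir hj2; rw [sq] at this; exact_mod_cast this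
  have hb := off_bounds r κ
  have hL1 : (3 : ℤ) ≤ P.L := by
    have h1 := P.hL.2; obtain ⟨k, hk⟩ := P.hL.1; push_cast [hk] at h1 ⊢; omega
  have hLL : (3 : ℤ) * P.L ≤ (P.L : ℤ) * P.L := mul_le_mul_of_nonneg_right hL1 (by linarith)
  rw [Pi.add_apply, Pi.add_apply, Pi.smul_apply, Pi.smul_apply, e_apply, e_apply, smul_eq_mul, smul_eq_mul]
  split_ifs <;> constructor <;> nlinarith

/-- **A point of the pair box lies in one of the blocks `B(y)`, `B(y+e_μ)`, `B(y+e_ν)`, `B(y+e_μ+e_ν)`** (`μ = ν` allowed: three blocks in a row; the `μ ≠ ν` case is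
pub-balaban3d's `blockOf_mem_four_of_near`, here uniformly).  Standing range `j + 1 ≤ m + K`. [cite: Balaban1987RG1, (0.3)-(0.4) pp.252-253] -/
theorem blockOf_transl_emb_pairBox (hj : j + 1 ≤ P.m + P.K) (y : Site P (j + 1)) (μ ν : Fin P.d) {z : LSite P.d}
    (hz : InBox (fun _ => -(((P.L - 1) / 2 : ℕ) : ℤ))
      (fun κ => (if κ = μ then (P.L : ℤ) else 0) + (if κ = ν then (P.L : ℤ) else 0) + (((P.L - 1) / 2 : ℕ) : ℤ)) z) :
    blockOf (transl (emb y) z) = y ∨ blockOf (transl (emb y) z) = y.shift μ ∨ blockOf (transl (emb y) z) = y.shift ν ∨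
      blockOf (transl (emb y) z) = (y.shift μ).shift ν := by
  have hL := AveragingRT.two_mul_half_add_one P
  set h : ℕ := (P.L - 1) / 2 with hh
  -- the two thresholds: one shift along `μ` past `h`, one (further) shift along `ν` past `h + L·[μ = ν]`
  have key : ∀ (α β : Bool), (α = true ↔ (h : ℤ) < z μ) → (β = true ↔ (h : ℤ) + (if μ = ν then (P.L : ℤ) else 0) < z ν) →
      blockOf (transl (emb y) z) = (if β then (if α then (y.shift μ).shift ν else y.shift ν) else (if α then y.shift μ else y)) := by
    intro α β hα hβ
    set y' : Site P (j + 1) := if β then (if α then (y.shift μ).shift ν else y.shift ν) else (if α then y.shift μ else y) with hy'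
    have hemb : ∀ κ, emb y' κ = emb y κ + (if κ = μ ∧ α = true then (P.L : ZMod (P.sitesPerDir j)) else 0) +
        (if κ = ν ∧ β = true then (P.L : ZMod (P.sitesPerDir j)) else 0) := by
      intro κ
      rw [hy']
      cases α <;> cases β <;> simp [emb_shift_apply]
    refine blockOf_eq_of_near_emb hj y' _
      (fun κ => z κ - (if κ = μ ∧ α = true then (P.L : ℤ) else 0) - (if κ = ν ∧ β = true then (P.L : ℤ) else 0)) ?_ ?_
    · intro κ
      rw [transl_apply, hemb κ]
      push_cast
      split_ifs <;> ring
    · intro κ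
      have h1 := (hz κ).1
      have h2 := (hz κ).2
      dsimp only at h1 h2
      by_cases hκμ : κ = μ
      · subst hκμ
        by_cases hκν : κ = ν
        · subst hκν
          simp only [if_true, true_and] at h2 ⊢
          have hβ' : β = true ↔ (h : ℤ) + (P.L : ℤ) < z κ := by simpa using hβ
          cases α <;> cases β
          · have : ¬ ((h : ℤ) < z κ) := fun hc => Bool.false_ne_true (hα.2 hc)
            simp only [Bool.false_eq_true, if_false, sub_zero]; constructor <;> omega
          · have : (h : ℤ) + (P.L : ℤ) < z κ := hβ'.1 rfl
            have : ¬ ((h : ℤ) < z κ) := fun hc => Bool.false_ne_true (hα.2 hc)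
            omega
          · have : (h : ℤ) < z κ := hα.1 rfl
            have : ¬ ((h : ℤ) + (P.L : ℤ) < z κ) := fun hc => Bool.false_ne_true (hβ'.2 hc)
            simp only [if_true, Bool.false_eq_true, if_false, sub_zero]; constructor <;> omega
          · have : (h : ℤ) < z κ := hα.1 rfl
            have : (h : ℤ) + (P.L : ℤ) < z κ := hβ'.1 rfl
            simp only [if_true]; constructor <;> omega
        · have hne : ¬ (ν = κ) := fun h' => hκν h'.symm
          simp only [if_true, hκν, if_false, add_zero, false_and, sub_zero] at h2 ⊢
          cases α
          · have : ¬ ((h : ℤ) < z κ) := fun hc => Bool.false_ne_true (hα.2 hc)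
            simp only [Bool.false_eq_true, and_false, if_false, sub_zero]; constructor <;> omega
          · have : (h : ℤ) < z κ := hα.1 rfl
            simp only [and_self, if_true]; constructor <;> omega
      · by_cases hκν : κ = ν
        · subst hκν
          have hne : ¬ (μ = κ) := fun h' => hκμ h'.symm
          simp only [hκμ, if_false, zero_add, if_true, false_and, sub_zero, hne, add_zero] at h2 hβ ⊢
          cases β
          · have : ¬ ((h : ℤ) < z κ) := fun hc => Bool.false_ne_true (hβ.2 (by simpa using hc))
            simp only [Bool.false_eq_true, and_false, if_false, sub_zero]; constructor <;> omega
          · have : (h : ℤ) < z κ := by simpa using hβ.1 rfl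
            simp only [and_self, if_true]; constructor <;> omega
        · simp only [hκμ, hκν, if_false, false_and, sub_zero, zero_add] at h2 ⊢
          constructor <;> omega
  by_cases hα : (h : ℤ) < z μ <;> by_cases hβ : (h : ℤ) + (if μ = ν then (P.L : ℤ) else 0) < z ν
  · right; right; right; simpa using key true true (by simp [hα]) (by simp [hβ])
  · right; left; simpa using key true false (by simp [hα]) (by simp [hβ])
  · right; right; left; simpa using key false true (by simp [hα]) (by simp [hβ])
  · left; simpa using key false false (by simp [hα]) (by simp [hβ])

/-- **A site of the (three or) four blocks has its relative position (w.r.t. `emb y`) in the pair box** (`j + 2 ≤ m + K`). [cite: Balaban1987RG1, (0.3)-(0.4) pp.252-253] -/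
theorem inBox_rel_of_pairBlocks (hj : j + 1 ≤ P.m + P.K) (hj2 : j + 2 ≤ P.m + P.K) (y : Site P (j + 1)) (μ ν : Fin P.d) {x : Site P j}
    (hx : blockOf x = y ∨ blockOf x = y.shift μ ∨ blockOf x = y.shift ν ∨ blockOf x = (y.shift μ).shift ν) :
    InBox (fun _ => -(((P.L - 1) / 2 : ℕ) : ℤ))
      (fun κ => (if κ = μ then (P.L : ℤ) else 0) + (if κ = ν then (P.L : ℤ) else 0) + (((P.L - 1) / 2 : ℕ) : ℤ)) (rel (emb y) x) := by
  obtain ⟨r, hr⟩ : ∃ r : Fin P.d → Fin P.L, x = Site.blockSite (blockOf x) r := ⟨_, eq_blockSite_blockEquiv hj x⟩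
  have hL0 : (0 : ℤ) ≤ (P.L : ℤ) := by positivity
  intro κ
  have hb := off_bounds r κ
  have hμ0 : (0 : ℤ) ≤ (if κ = μ then (P.L : ℤ) else 0) := by split_ifs <;> omega
  have hν0 : (0 : ℤ) ≤ (if κ = ν then (P.L : ℤ) else 0) := by split_ifs <;> omega
  rcases hx with h | h | h | h <;> rw [h] at hr <;> rw [hr]
  · rw [rel_emb_blockSite hj]; dsimp only; constructor <;> omega
  · rw [rel_emb_blockSite_shift hj2, Pi.add_apply, Pi.smul_apply, e_apply, smul_eq_mul]; dsimp only
    by_cases hκ : κ = μ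
    · subst hκ; simp only [if_true, mul_one]; constructor <;> omega
    · simp only [if_neg hκ, mul_zero]; constructor <;> omega
  · rw [rel_emb_blockSite_shift hj2, Pi.add_apply, Pi.smul_apply, e_apply, smul_eq_mul]; dsimp only
    by_cases hκ : κ = ν
    · subst hκ; simp only [if_true, mul_one]; constructor <;> omega
    · simp only [if_neg hκ, mul_zero]; constructor <;> omega
  · rw [rel_emb_blockSite_shift_shift hj2, Pi.add_apply, Pi.add_apply, Pi.smul_apply, Pi.smul_apply, e_apply, e_apply, smul_eq_mul, smul_eq_mul]
    dsimp only
    by_cases hκ : κ = μ <;> by_cases hκ' : κ = ν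
    · subst hκ; simp only [if_true, mul_one, if_pos hκ']; constructor <;> omega
    · subst hκ; simp only [if_true, mul_one, if_neg hκ', mul_zero]; constructor <;> omega
    · subst hκ'; simp only [if_true, mul_one, if_neg hκ, mul_zero]; constructor <;> omega
    · simp only [if_neg hκ, if_neg hκ', mul_zero]; constructor <;> omega

/-- **No wrap-around on the pair box** (`2(z_κ + 1) ≤` period, since `z_κ ≤ 2L + h` and the period is `≥ 2L²`, `L ≥ 3`). [cite: Balaban1987RG1, (0.1) p.251] -/
theorem noWrap_of_inPairBox (hj2 : j + 2 ≤ P.m + P.K) {μ ν : Fin P.d} {z : LSite P.d}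
    (hz : InBox (fun _ => -(((P.L - 1) / 2 : ℕ) : ℤ))
      (fun κ => (if κ = μ then (P.L : ℤ) else 0) + (if κ = ν then (P.L : ℤ) else 0) + (((P.L - 1) / 2 : ℕ) : ℤ)) z) (κ : Fin P.d) :
    (z κ + 1) * 2 ≤ (P.sitesPerDir j : ℤ) := by
  have hL : (2 : ℤ) * (((P.L - 1) / 2 : ℕ) : ℤ) + 1 = P.L := by exact_mod_cast AveragingRT.two_mul_half_add_one P
  have hn : (2 : ℤ) * ((P.L : ℤ) * P.L) ≤ (P.sitesPerDir j : ℤ) := by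
    have := two_mul_sq_le_sitesPerDir hj2; rw [sq] at this; exact_mod_cast this
  have hL1 : (3 : ℤ) ≤ P.L := by
    have h1 := P.hL.2; obtain ⟨k, hk⟩ := P.hL.1; push_cast [hk] at h1 ⊢; omega
  have h := (hz κ).2
  dsimp only at h
  -- `5L + 1 ≤ 2L²` for `L ≥ 3`
  have hLL : (5 : ℤ) * P.L + 1 ≤ 2 * ((P.L : ℤ) * P.L) := by nlinarith
  split_ifs at h <;> nlinarith

/-- The `ℓ¹`-radius of the pair box about its centre point: `2|z|₁ ≤ d(L−1) + 4L ≤ (d+4)L`. [folklore] -/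
theorem two_mul_l1_le_of_inPairBox {μ ν : Fin P.d} {z : LSite P.d}
    (hz : InBox (fun _ => -(((P.L - 1) / 2 : ℕ) : ℤ))
      (fun κ => (if κ = μ then (P.L : ℤ) else 0) + (if κ = ν then (P.L : ℤ) else 0) + (((P.L - 1) / 2 : ℕ) : ℤ)) z) :
    2 * l1 z ≤ (P.d + 4) * P.L := by
  have hL := AveragingRT.two_mul_half_add_one P
  set h : ℕ := (P.L - 1) / 2 with hh
  have hle : ∀ κ, (z κ).natAbs ≤ h + (if κ = μ then P.L else 0) + (if κ = ν then P.L else 0) := fun κ => by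
    have h1 := (hz κ).1; have h2 := (hz κ).2
    dsimp only at h1 h2
    split_ifs at h2 ⊢ <;> omega
  have hsum : l1 z ≤ P.d * h + P.L + P.L := by
    unfold l1
    calc ∑ κ, (z κ).natAbs ≤ ∑ κ, (h + (if κ = μ then P.L else 0) + (if κ = ν then P.L else 0)) := Finset.sum_le_sum fun κ _ => hle κ
      _ = P.d * h + P.L + P.L := by
        rw [Finset.sum_add_distrib, Finset.sum_add_distrib, Finset.sum_const, Finset.card_univ, Fintype.card_fin, smul_eq_mul,
          Finset.sum_ite_eq', Finset.sum_ite_eq']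
        simp
  have hid : (P.d + 4) * P.L = 2 * (P.d * h + P.L + P.L) + P.d := by rw [← hL]; ring
  omega

/-- The pair box is a genuine box (`lo ≤ hi`). [folklore] -/
theorem pairBox_lo_le_hi (μ ν κ : Fin P.d) :
    (fun _ => -(((P.L - 1) / 2 : ℕ) : ℤ) : LSite P.d) κ ≤
      (fun κ => (if κ = μ then (P.L : ℤ) else 0) + (if κ = ν then (P.L : ℤ) else 0) + (((P.L - 1) / 2 : ℕ) : ℤ) : LSite P.d) κ := by
  dsimp only
  split_ifs <;> omega

/-- For a bond with both ends in the blocks, the relative position of its target is that of its source displaced by `e_κ` (no wrap). [cite: Balaban1987RG1, (0.3) p.252] -/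
theorem rel_tgt_of_pairBlocks (hj : j + 1 ≤ P.m + P.K) (hj2 : j + 2 ≤ P.m + P.K) (y : Site P (j + 1)) (μ ν : Fin P.d) (b : PBond P j)
    (h1 : blockOf b.src = y ∨ blockOf b.src = y.shift μ ∨ blockOf b.src = y.shift ν ∨ blockOf b.src = (y.shift μ).shift ν) :
    rel (emb y) b.tgt = rel (emb y) b.src + e b.dir :=
  rel_shift_of_le _ _ _ (noWrap_of_inPairBox hj2 (inBox_rel_of_pairBlocks hj hj2 y μ ν h1) b.dir)

end Geometry

/-! ## §2 The axial gauge based at `emb y` on the pair box -/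

section Gauge

/-- Two fields agreeing on the bonds with both ends in the blocks have pullbacks (based at `emb y`) agreeing on the pair box. [cite: Balaban1987RG1, (0.3) p.252] -/
theorem agreeOn_pull_of_pairBlocks {G : Type*} [Group G] (hj : j + 1 ≤ P.m + P.K) (y : Site P (j + 1)) (μ ν : Fin P.d) {V V' : GaugeField P j G}
    (h : ∀ b : PBond P j, (blockOf b.src = y ∨ blockOf b.src = y.shift μ ∨ blockOf b.src = y.shift ν ∨ blockOf b.src = (y.shift μ).shift ν) →
      (blockOf b.tgt = y ∨ blockOf b.tgt = y.shift μ ∨ blockOf b.tgt = y.shift ν ∨ blockOf b.tgt = (y.shift μ).shift ν) → V b = V' b) :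
    AgreeOn (fun _ => -(((P.L - 1) / 2 : ℕ) : ℤ))
      (fun κ => (if κ = μ then (P.L : ℤ) else 0) + (if κ = ν then (P.L : ℤ) else 0) + (((P.L - 1) / 2 : ℕ) : ℤ))
      (pull V (emb y)) (pull V' (emb y)) := fun z κ hz hzκ => by
  rw [pull_apply, pull_apply]
  refine h _ (blockOf_transl_emb_pairBox hj y μ ν hz) ?_
  rw [PBond.tgt, ← transl_add_e]
  exact blockOf_transl_emb_pairBox hj y μ ν hzκ

/-- **The axial gauge based at `emb y`, evaluated on the blocks, reads only the bonds with both ends in the blocks.** [cite: Balaban1985Averaging, p.24] -/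
theorem axialT_congr_of_pairBlocks {G : Type*} [Group G] (hj : j + 1 ≤ P.m + P.K) (hj2 : j + 2 ≤ P.m + P.K) (y : Site P (j + 1)) (μ ν : Fin P.d)
    {V V' : GaugeField P j G}
    (h : ∀ b : PBond P j, (blockOf b.src = y ∨ blockOf b.src = y.shift μ ∨ blockOf b.src = y.shift ν ∨ blockOf b.src = (y.shift μ).shift ν) →
      (blockOf b.tgt = y ∨ blockOf b.tgt = y.shift μ ∨ blockOf b.tgt = y.shift ν ∨ blockOf b.tgt = (y.shift μ).shift ν) → V b = V' b)
    {x : Site P j} (hx : blockOf x = y ∨ blockOf x = y.shift μ ∨ blockOf x = y.shift ν ∨ blockOf x = (y.shift μ).shift ν) :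
    axialT V (emb y) x = axialT V' (emb y) x := by
  rw [axialT, axialT, ← hol_pull_zero, ← hol_pull_zero]
  have h0 : InBox (fun _ => -(((P.L - 1) / 2 : ℕ) : ℤ))
      (fun κ => (if κ = μ then (P.L : ℤ) else 0) + (if κ = ν then (P.L : ℤ) else 0) + (((P.L - 1) / 2 : ℕ) : ℤ)) (0 : LSite P.d) :=
    fun κ => by dsimp only; simp only [Pi.zero_apply]; split_ifs <;> omega
  exact hol_treeWord_congr (agreeOn_pull_of_pairBlocks hj y μ ν h) 0 _ h0 (by rw [zero_add]; exact inBox_rel_of_pairBlocks hj hj2 y μ ν hx)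

variable {𝔸 : Type*} [NormedRing 𝔸] [NormOneClass 𝔸]

/-- The periodic pullback `pull U (emb y)` is `U1`-valued on the bonds of the pair box when `U` is on the bonds with both ends in the blocks. [cite: Balaban1985Averaging, (9) p.18] -/
theorem pull_mem_U1_of_pairBlocks (hj : j + 1 ≤ P.m + P.K) {U : GaugeField P j 𝔸ˣ} (y : Site P (j + 1)) (μ ν : Fin P.d)
    (hU1 : ∀ b : PBond P j, (blockOf b.src = y ∨ blockOf b.src = y.shift μ ∨ blockOf b.src = y.shift ν ∨ blockOf b.src = (y.shift μ).shift ν) →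
      (blockOf b.tgt = y ∨ blockOf b.tgt = y.shift μ ∨ blockOf b.tgt = y.shift ν ∨ blockOf b.tgt = (y.shift μ).shift ν) → U b ∈ U1 𝔸)
    (z : LSite P.d) (κ : Fin P.d)
    (hz : InBox (fun _ => -(((P.L - 1) / 2 : ℕ) : ℤ))
      (fun κ => (if κ = μ then (P.L : ℤ) else 0) + (if κ = ν then (P.L : ℤ) else 0) + (((P.L - 1) / 2 : ℕ) : ℤ)) z)
    (hzκ : InBox (fun _ => -(((P.L - 1) / 2 : ℕ) : ℤ))
      (fun κ => (if κ = μ then (P.L : ℤ) else 0) + (if κ = ν then (P.L : ℤ) else 0) + (((P.L - 1) / 2 : ℕ) : ℤ)) (z + e κ)) :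
    pull U (emb y) z κ ∈ U1 𝔸 := by
  rw [pull_apply]
  refine hU1 _ (blockOf_transl_emb_pairBox hj y μ ν hz) ?_
  rw [PBond.tgt, ← transl_add_e]
  exact blockOf_transl_emb_pairBox hj y μ ν hzκ

/-- The plaquette variables of the pullback inside the pair box (both orientations) are within `a` of `1` when the plaquettes of `U` with all four corners in the blocks are.
[cite: Balaban1985Averaging, (9) p.19 and (19)-(20) p.21] -/
theorem norm_hol_pull_plaqWord_sub_one_le_of_pairBlocks (hj : j + 1 ≤ P.m + P.K) {U : GaugeField P j 𝔸ˣ} (y : Site P (j + 1)) (μ ν : Fin P.d) {a : ℝ}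
    (hU1 : ∀ b : PBond P j, (blockOf b.src = y ∨ blockOf b.src = y.shift μ ∨ blockOf b.src = y.shift ν ∨ blockOf b.src = (y.shift μ).shift ν) →
      (blockOf b.tgt = y ∨ blockOf b.tgt = y.shift μ ∨ blockOf b.tgt = y.shift ν ∨ blockOf b.tgt = (y.shift μ).shift ν) → U b ∈ U1 𝔸)
    (hplaq : ∀ p : Plaq P j, (blockOf p.src = y ∨ blockOf p.src = y.shift μ ∨ blockOf p.src = y.shift ν ∨ blockOf p.src = (y.shift μ).shift ν) →
      (blockOf (p.src.shift p.μ) = y ∨ blockOf (p.src.shift p.μ) = y.shift μ ∨ blockOf (p.src.shift p.μ) = y.shift ν ∨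
        blockOf (p.src.shift p.μ) = (y.shift μ).shift ν) →
      (blockOf (p.src.shift p.ν) = y ∨ blockOf (p.src.shift p.ν) = y.shift μ ∨ blockOf (p.src.shift p.ν) = y.shift ν ∨
        blockOf (p.src.shift p.ν) = (y.shift μ).shift ν) →
      (blockOf ((p.src.shift p.μ).shift p.ν) = y ∨ blockOf ((p.src.shift p.μ).shift p.ν) = y.shift μ ∨
        blockOf ((p.src.shift p.μ).shift p.ν) = y.shift ν ∨ blockOf ((p.src.shift p.μ).shift p.ν) = (y.shift μ).shift ν) →
      ‖((plaq U p : 𝔸ˣ) : 𝔸) - 1‖ ≤ a)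
    (z : LSite P.d) (κ κ' : Fin P.d) (hκκ' : κ ≠ κ')
    (hp : PlaqIn (fun _ => -(((P.L - 1) / 2 : ℕ) : ℤ))
      (fun κ => (if κ = μ then (P.L : ℤ) else 0) + (if κ = ν then (P.L : ℤ) else 0) + (((P.L - 1) / 2 : ℕ) : ℤ)) (z, κ, κ')) :
    ‖((hol (pull U (emb y)) z (plaqWord κ κ') : 𝔸ˣ) : 𝔸) - 1‖ ≤ a := by
  obtain ⟨hz, hzκκ'⟩ := hp
  have hzκ := inBox_add_e_of_inBox_add_add hz hzκκ'
  have hzκ'κ : InBox (fun _ => -(((P.L - 1) / 2 : ℕ) : ℤ))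
      (fun κ => (if κ = μ then (P.L : ℤ) else 0) + (if κ = ν then (P.L : ℤ) else 0) + (((P.L - 1) / 2 : ℕ) : ℤ)) (z + e κ' + e κ) := by
    rwa [add_right_comm]
  have hzκ' := inBox_add_e_of_inBox_add_add hz hzκ'κ
  have c1 := blockOf_transl_emb_pairBox hj y μ ν hz
  have c2 := blockOf_transl_emb_pairBox hj y μ ν hzκ
  have c3 := blockOf_transl_emb_pairBox hj y μ ν hzκ'
  have c4 := blockOf_transl_emb_pairBox hj y μ ν hzκκ'
  have c4' := blockOf_transl_emb_pairBox hj y μ ν hzκ'κ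
  rw [transl_add_e] at c2 c3
  rw [transl_add_e, transl_add_e] at c4 c4'
  rw [hol_pull]
  rcases lt_or_gt_of_ne hκκ' with hlt | hgt
  · have h := hplaq ⟨transl (emb y) z, κ, κ', hlt⟩ c1 c2 c3 c4
    rwa [plaq_eq, ← holT_plaqWord] at h
  · have h := hplaq ⟨transl (emb y) z, κ', κ, hgt⟩ c1 c3 c2 c4'
    rw [plaq_eq, ← holT_plaqWord] at h
    have hmem : holT U (transl (emb y) z) (plaqWord κ' κ) ∈ U1 𝔸 := by
      rw [holT_plaqWord]
      refine (U1 𝔸).mul_mem ((U1 𝔸).mul_mem ((U1 𝔸).mul_mem (hU1 _ c1 c3) (hU1 _ c3 c4')) ((U1 𝔸).inv_mem (hU1 _ c2 c4)))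
        ((U1 𝔸).inv_mem (hU1 _ c1 c2))
    rw [holT_plaqWord_swap]
    exact (norm_inv_sub_one_le hmem).trans h

/-- ★ **THE AXIAL GAUGE BASED AT `emb y` MAKES THE BOND VARIABLES OF THE PAIR BOX SMALL FROM ITS PLAQUETTES**: for a GLOBALLY bi-contractive `V` (apply to the factor
cut off to `1` off the blocks) whose plaquettes with all four corners in the blocks are within `α` of `1`, every bond with both ends in the blocks has
`‖V^{v₀}(b) − 1‖ ≤ ((d+4)L∕2)·α`, `v₀ = axialT V (emb y)` (`j + 2 ≤ m + K`). [cite: Balaban1985Averaging, pp.24-25; Balaban1985UV3, (27) p.263] -/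
theorem norm_gaugeU_axialT_sub_one_le_of_pairBlocks (hj : j + 1 ≤ P.m + P.K) (hj2 : j + 2 ≤ P.m + P.K) {V : GaugeField P j 𝔸ˣ} (hV : ∀ b, V b ∈ U1 𝔸)
    (y : Site P (j + 1)) (μ ν : Fin P.d) {α : ℝ} (hα : 0 ≤ α)
    (hplaq : ∀ p : Plaq P j, (blockOf p.src = y ∨ blockOf p.src = y.shift μ ∨ blockOf p.src = y.shift ν ∨ blockOf p.src = (y.shift μ).shift ν) →
      (blockOf (p.src.shift p.μ) = y ∨ blockOf (p.src.shift p.μ) = y.shift μ ∨ blockOf (p.src.shift p.μ) = y.shift ν ∨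
        blockOf (p.src.shift p.μ) = (y.shift μ).shift ν) →
      (blockOf (p.src.shift p.ν) = y ∨ blockOf (p.src.shift p.ν) = y.shift μ ∨ blockOf (p.src.shift p.ν) = y.shift ν ∨
        blockOf (p.src.shift p.ν) = (y.shift μ).shift ν) →
      (blockOf ((p.src.shift p.μ).shift p.ν) = y ∨ blockOf ((p.src.shift p.μ).shift p.ν) = y.shift μ ∨
        blockOf ((p.src.shift p.μ).shift p.ν) = y.shift ν ∨ blockOf ((p.src.shift p.μ).shift p.ν) = (y.shift μ).shift ν) →
      ‖((plaq V p : 𝔸ˣ) : 𝔸) - 1‖ ≤ α)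
    (b : PBond P j) (h1 : blockOf b.src = y ∨ blockOf b.src = y.shift μ ∨ blockOf b.src = y.shift ν ∨ blockOf b.src = (y.shift μ).shift ν)
    (h2 : blockOf b.tgt = y ∨ blockOf b.tgt = y.shift μ ∨ blockOf b.tgt = y.shift ν ∨ blockOf b.tgt = (y.shift μ).shift ν) :
    ‖((gaugeU (axialT V (emb y)) V b : 𝔸ˣ) : 𝔸) - 1‖ ≤ ((((P.d + 4) * P.L : ℕ) : ℝ) / 2) * α := by
  have hsrc := inBox_rel_of_pairBlocks hj hj2 y μ ν h1
  have htgt : InBox (fun _ => -(((P.L - 1) / 2 : ℕ) : ℤ))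
      (fun κ => (if κ = μ then (P.L : ℤ) else 0) + (if κ = ν then (P.L : ℤ) else 0) + (((P.L - 1) / 2 : ℕ) : ℤ)) (rel (emb y) b.src + e b.dir) := by
    rw [← rel_tgt_of_pairBlocks hj hj2 y μ ν b h1]; exact inBox_rel_of_pairBlocks hj hj2 y μ ν h2
  have h0 : InBox (fun _ => -(((P.L - 1) / 2 : ℕ) : ℤ))
      (fun κ => (if κ = μ then (P.L : ℤ) else 0) + (if κ = ν then (P.L : ℤ) else 0) + (((P.L - 1) / 2 : ℕ) : ℤ)) (0 : LSite P.d) :=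
    fun κ => by dsimp only; simp only [Pi.zero_apply]; split_ifs <;> omega
  have heq : gaugeU (axialT V (emb y)) V b = holT V (emb y) (B10Eq27TorusAxialLog.contourT (emb y) b) := by
    rw [holT_contourT_eq_gaugeActT V (emb y) b (noWrap_of_inPairBox hj2 hsrc b.dir), gaugeActT_apply]; rfl
  rw [heq]
  have h13 : ∀ (z : LSite P.d) (κ κ' : Fin P.d), κ ≠ κ' →
      PlaqIn (fun _ => -(((P.L - 1) / 2 : ℕ) : ℤ))
        (fun κ => (if κ = μ then (P.L : ℤ) else 0) + (if κ = ν then (P.L : ℤ) else 0) + (((P.L - 1) / 2 : ℕ) : ℤ)) (z, κ, κ') →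
      ‖((holT V (transl (emb y) z) (plaqWord κ κ') : 𝔸ˣ) : 𝔸) - 1‖ ≤ α := fun z κ κ' hκκ' hp => by
    rw [← hol_pull]
    exact norm_hol_pull_plaqWord_sub_one_le_of_pairBlocks hj y μ ν (fun b' _ _ => hV b') hplaq z κ κ' hκκ' hp
  have hmain := norm_holT_contourT_sub_one_le (pairBox_lo_le_hi μ ν) V hV (emb y) h13 hα h0 b hsrc htgt
  refine hmain.trans (mul_le_mul_of_nonneg_right ?_ hα)
  have h2l : (2 : ℝ) * (l1 (rel (emb y) b.src) : ℝ) ≤ (((P.d + 4) * P.L : ℕ) : ℝ) := by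
    exact_mod_cast two_mul_l1_le_of_inPairBox hsrc
  linarith

end Gauge

end YMDAG.N18.TransportOfRecord

end
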